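import Summits.Ventures.Crystal3D.Theorems.StickyWulffConstantGenericWallFloorStackWalkStarExclusion
import HarnessLib

/-!
# No well-formed word rooted IN-PLANE for a letter of the relating word carries the top grain's slots (multi-letter form)
# (lane T, crux `TextureLiminfV5`, stmt-Ventures-23912, line `TexShadow`, re-targeted `stub_terraceCensus`; 19480-p1 g20 — the THREADING lemma of the
#  (β)-lite plan: lane F's two-plate word net on a pair related by a reduced word of ANY length)

HONEST FRAMING. Venture `Summits/Ventures/Crystal3D` (cell `crystal3d-full`), route `route-Ventures-StickyWulffConstant`, helper `--supports` the
law-v5 crux `TextureLiminfV5` (stmt-Ventures-23912), lane T.  Pure word algebra in the abstract automaton setting of 19481-p2's `…WordRigidity` /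
`…WordNoTop` (frames `F (μ :: κ) = R_μ.trans (F κ)`, model directions `u (μ :: κ) = −u κ`, well-formedness `WF`); no configuration, no certificate,
nothing about energies; F-C1 not moved.

THE POINT.  Lane F's top exclusion `word_image_ne_mirror_of_inner_zero` (…WordNoTop) is the ONE-LETTER case: a root in-plane for `m` never reaches
the twin `F [] ∘ R_m`.  For a pair of plates whose lattices are related by a reduced admissible word `w₀` of ANY length (`G₂·S = wordFrame (F []) w₀·S`
— the Σ9 / Σ27 / … pairs of the terrace census), the same holds for every root that is IN-PLANE FOR AT LEAST ONE LETTER of `w₀`: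
* `word_F_eq_wordFrame` — `F κ = wordFrame (F []) κ` (same recursion);
* `word_u_eq_or` — `u κ = ± u []`; `word_inner_root_of_wf` — every letter `μ` of a well-formed word is POLAR for the root: `⟪u [], μ⟫ = ±√(2/3)`;
* **`word_image_ne_wordFrame_of_inner_zero`** — if `m ∈ w₀` and `⟪u [], m⟫ = 0` then no well-formed `κ` has `F κ '' S = wordFrame (F []) w₀ '' S`
  (by `map_reflection_eq_of_image_eq` the mirror lists of `κ` and `w₀` agree, so `m = ±μ'` for a letter `μ'` of `κ`, which is polar for the root);
* `word_noTop_of_inner_zero_word` — the TRIANGLE form (verbatim the hypothesis `hnotop` / `hPexcl0` shape of the word-net counts): no well-formed word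
  has a `60°` triangle of its slots inside `G₂ '' S`; `word_noTop_of_inner_zero_lattice` — the same with the hypothesis stated on LATTICES
  (`G₂ '' Λ₀ = wordFrame (F []) w₀ '' Λ₀`, the shape of `CensusDominatedAt` / `SigmaNineSliverAt`).
CONSEQUENCE (the root budget of (β)-lite, not formalised here): a slot is in-plane for exactly two of the four `{111}` normals, so the roots that can
thread `w₀` are those polar to EVERY letter — none unless the letters of `w₀` alternate between two normals (`[a,b]`, `[a,b,a]`, …: the `⟨110⟩` tilt
chain Σ9, Σ27a, Σ81, …), and then exactly the `±` pair of common slots of the other two planes, i.e. at most ONE rising root class per plate.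
WHAT THIS IS NOT: not the word-net count, not the certificate, not the cell assembly; F-C1 not moved.
-/

noncomputable section

namespace Summit.Ventures.Crystal3D.Theorems

open Summit.Ventures.Crystal3D Finset
open Literature.MathematicalPhysics.StatisticalMechanics (fccStacking)
open scoped InnerProductSpace

section Threading

variable {F : List (EuclideanSpace ℝ (Fin 3)) → (EuclideanSpace ℝ (Fin 3) ≃ₗᵢ[ℝ] EuclideanSpace ℝ (Fin 3))}
  {u : List (EuclideanSpace ℝ (Fin 3)) → EuclideanSpace ℝ (Fin 3)}
  {WF : List (EuclideanSpace ℝ (Fin 3)) → Prop}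

/-- The automaton's frames ARE the word frames over the root frame: `F κ = wordFrame (F []) κ`. -/
theorem word_F_eq_wordFrame (hFc : ∀ μ κ, F (μ :: κ) = ((ℝ ∙ μ)ᗮ.reflection).trans (F κ)) :
    ∀ κ, F κ = wordFrame (F []) κ
  | [] => rfl
  | μ :: κ => by rw [hFc, wordFrame_cons, word_F_eq_wordFrame hFc κ]

/-- The model direction of a class is `±` the root direction. -/
theorem word_u_eq_or (huc : ∀ μ κ, u (μ :: κ) = -u κ) : ∀ κ, u κ = u [] ∨ u κ = -u []
  | [] => Or.inl rfl
  | μ :: κ => by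
    rw [huc]
    rcases word_u_eq_or huc κ with h | h
    · exact Or.inr (by rw [h])
    · exact Or.inl (by rw [h, neg_neg])

/-- **Every letter of a well-formed word is POLAR for the root**: `⟪u [], μ⟫ = ±√(2/3)`. -/
theorem word_inner_root_of_wf (huc : ∀ μ κ, u (μ :: κ) = -u κ)
    (hWFc : ∀ μ κ, WF (μ :: κ) ↔ (WF κ ∧ ‖μ‖ = 1 ∧
      (∀ w ∈ fccSlots, ⟪w, μ⟫_ℝ = 0 ∨ ⟪w, μ⟫_ℝ = Real.sqrt (2 / 3) ∨ ⟪w, μ⟫_ℝ = -Real.sqrt (2 / 3)) ∧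
      ⟪u κ, μ⟫_ℝ = Real.sqrt (2 / 3) ∧ ∀ μ' κ', κ = μ' :: κ' → μ' ≠ -μ)) :
    ∀ κ, WF κ → ∀ μ ∈ κ, ⟪u [], μ⟫_ℝ = Real.sqrt (2 / 3) ∨ ⟪u [], μ⟫_ℝ = -Real.sqrt (2 / 3)
  | [], _, μ, hμ => by simp at hμ
  | ν :: κ, hκ, μ, hμ => by
    obtain ⟨hκ', -, -, hνu, -⟩ := (hWFc ν κ).1 hκ
    rcases List.mem_cons.1 hμ with rfl | hμ'
    · rcases word_u_eq_or huc κ with h | h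
      · exact Or.inl (by rw [← h]; exact hνu)
      · refine Or.inr ?_
        rw [h, inner_neg_left] at hνu
        linarith
    · exact word_inner_root_of_wf huc hWFc κ hκ' μ hμ'

/-- **No well-formed word rooted in-plane for a letter of `w₀` has the slot dozen of `wordFrame (F []) w₀`.**  See the module docstring. -/
theorem word_image_ne_wordFrame_of_inner_zero
    (hFc : ∀ μ κ, F (μ :: κ) = ((ℝ ∙ μ)ᗮ.reflection).trans (F κ))
    (huc : ∀ μ κ, u (μ :: κ) = -u κ)
    (hWFc : ∀ μ κ, WF (μ :: κ) ↔ (WF κ ∧ ‖μ‖ = 1 ∧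
      (∀ w ∈ fccSlots, ⟪w, μ⟫_ℝ = 0 ∨ ⟪w, μ⟫_ℝ = Real.sqrt (2 / 3) ∨ ⟪w, μ⟫_ℝ = -Real.sqrt (2 / 3)) ∧
      ⟪u κ, μ⟫_ℝ = Real.sqrt (2 / 3) ∧ ∀ μ' κ', κ = μ' :: κ' → μ' ≠ -μ))
    {w₀ : List (EuclideanSpace ℝ (Fin 3))}
    (hw₀l : ∀ μ ∈ w₀, ‖μ‖ = 1 ∧
      ∀ w ∈ fccSlots, ⟪w, μ⟫_ℝ = 0 ∨ ⟪w, μ⟫_ℝ = Real.sqrt (2 / 3) ∨ ⟪w, μ⟫_ℝ = -Real.sqrt (2 / 3))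
    (hw₀c : List.IsChain (fun μ μ' => ⟪μ, μ'⟫_ℝ = 1 / 3 ∨ ⟪μ, μ'⟫_ℝ = -1 / 3) w₀)
    {m : EuclideanSpace ℝ (Fin 3)} (hm : m ∈ w₀) (horth : ⟪u [], m⟫_ℝ = 0)
    {κ : List (EuclideanSpace ℝ (Fin 3))} (hκ : WF κ) :
    (F κ : EuclideanSpace ℝ (Fin 3) → EuclideanSpace ℝ (Fin 3)) '' ↑fccSlots ≠
      (wordFrame (F []) w₀ : EuclideanSpace ℝ (Fin 3) → EuclideanSpace ℝ (Fin 3)) '' ↑fccSlots := by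
  intro himg
  have hr : 0 < Real.sqrt (2 / 3) := Real.sqrt_pos.2 (by norm_num)
  rw [word_F_eq_wordFrame hFc κ] at himg
  obtain ⟨hlet, hchain⟩ := word_letters_of_wf huc hWFc κ hκ
  have hmap := map_reflection_eq_of_image_eq (F []) hlet hchain hw₀l hw₀c himg
  -- the mirror of `m` is the mirror of a letter `μ'` of `κ`
  have hmem : (ℝ ∙ m)ᗮ.reflection ∈ w₀.map (fun μ => (ℝ ∙ μ)ᗮ.reflection) := List.mem_map.2 ⟨m, hm, rfl⟩
  rw [← hmap] at hmem
  obtain ⟨μ', hμ', heq⟩ := List.mem_map.1 hmem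
  have hμ'1 : ‖μ'‖ = 1 := (hlet μ' hμ').1
  have hm1 : ‖m‖ = 1 := (hw₀l m hm).1
  have hpol := word_inner_root_of_wf huc hWFc κ hκ μ' hμ'
  rcases eq_or_eq_neg_of_reflection_eq hμ'1 hm1 heq with h | h
  · rw [h] at hpol
    rcases hpol with h' | h' <;> rw [h'] at horth <;> linarith
  · rw [h, inner_neg_right] at hpol
    rcases hpol with h' | h' <;> linarith

/-- **Triangle form** (the shape of the hypothesis `hnotop` / `hPexcl0` of the word-net counts): with a root in-plane for some letter of `w₀`, no
well-formed word has a `60°` triangle of its slots inside the slot dozen of a frame `G₂` whose slot dozen is that of `wordFrame (F []) w₀`. -/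
theorem word_noTop_of_inner_zero_word
    (hFc : ∀ μ κ, F (μ :: κ) = ((ℝ ∙ μ)ᗮ.reflection).trans (F κ))
    (huc : ∀ μ κ, u (μ :: κ) = -u κ)
    (hWFc : ∀ μ κ, WF (μ :: κ) ↔ (WF κ ∧ ‖μ‖ = 1 ∧
      (∀ w ∈ fccSlots, ⟪w, μ⟫_ℝ = 0 ∨ ⟪w, μ⟫_ℝ = Real.sqrt (2 / 3) ∨ ⟪w, μ⟫_ℝ = -Real.sqrt (2 / 3)) ∧
      ⟪u κ, μ⟫_ℝ = Real.sqrt (2 / 3) ∧ ∀ μ' κ', κ = μ' :: κ' → μ' ≠ -μ))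
    {w₀ : List (EuclideanSpace ℝ (Fin 3))}
    (hw₀l : ∀ μ ∈ w₀, ‖μ‖ = 1 ∧
      ∀ w ∈ fccSlots, ⟪w, μ⟫_ℝ = 0 ∨ ⟪w, μ⟫_ℝ = Real.sqrt (2 / 3) ∨ ⟪w, μ⟫_ℝ = -Real.sqrt (2 / 3))
    (hw₀c : List.IsChain (fun μ μ' => ⟪μ, μ'⟫_ℝ = 1 / 3 ∨ ⟪μ, μ'⟫_ℝ = -1 / 3) w₀)
    {m : EuclideanSpace ℝ (Fin 3)} (hm : m ∈ w₀) (horth : ⟪u [], m⟫_ℝ = 0)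
    (G₂ : EuclideanSpace ℝ (Fin 3) ≃ₗᵢ[ℝ] EuclideanSpace ℝ (Fin 3))
    (hG₂ : (G₂ : EuclideanSpace ℝ (Fin 3) → EuclideanSpace ℝ (Fin 3)) '' ↑fccSlots =
      (wordFrame (F []) w₀ : EuclideanSpace ℝ (Fin 3) → EuclideanSpace ℝ (Fin 3)) '' ↑fccSlots)
    {κ : List (EuclideanSpace ℝ (Fin 3))} (hκ : WF κ) :
    ¬ (∃ a ∈ fccSlots, ∃ a' ∈ fccSlots, ∃ a'' ∈ fccSlots,
        ⟪a, a'⟫_ℝ = 1 / 2 ∧ ⟪a, a''⟫_ℝ = 1 / 2 ∧ ⟪a', a''⟫_ℝ = 1 / 2 ∧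
        (∃ w ∈ fccSlots, G₂ w = F κ a) ∧ (∃ w ∈ fccSlots, G₂ w = F κ a') ∧
        (∃ w ∈ fccSlots, G₂ w = F κ a'')) := by
  rintro ⟨a, ha, a', ha', a'', ha'', i1, i2, i3, ⟨w₁, hw₁, e₁⟩, ⟨w₂, hw₂, e₂⟩, ⟨w₃, hw₃, e₃⟩⟩
  have himg := image_fccSlots_eq_of_triangle (F κ) G₂ ha ha' ha'' i1 i2 i3
    ⟨w₁, Finset.mem_coe.2 hw₁, e₁⟩ ⟨w₂, Finset.mem_coe.2 hw₂, e₂⟩ ⟨w₃, Finset.mem_coe.2 hw₃, e₃⟩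
  rw [hG₂] at himg
  exact word_image_ne_wordFrame_of_inner_zero hFc huc hWFc hw₀l hw₀c hm horth hκ himg

/-- **Lattice form** (the hypothesis as it appears in `CensusDominatedAt` / `SigmaNineSliverAt`: the top grain's LATTICE is the word frame's lattice):
the same conclusion. -/
theorem word_noTop_of_inner_zero_lattice
    (hFc : ∀ μ κ, F (μ :: κ) = ((ℝ ∙ μ)ᗮ.reflection).trans (F κ))
    (huc : ∀ μ κ, u (μ :: κ) = -u κ)
    (hWFc : ∀ μ κ, WF (μ :: κ) ↔ (WF κ ∧ ‖μ‖ = 1 ∧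
      (∀ w ∈ fccSlots, ⟪w, μ⟫_ℝ = 0 ∨ ⟪w, μ⟫_ℝ = Real.sqrt (2 / 3) ∨ ⟪w, μ⟫_ℝ = -Real.sqrt (2 / 3)) ∧
      ⟪u κ, μ⟫_ℝ = Real.sqrt (2 / 3) ∧ ∀ μ' κ', κ = μ' :: κ' → μ' ≠ -μ))
    {w₀ : List (EuclideanSpace ℝ (Fin 3))}
    (hw₀l : ∀ μ ∈ w₀, ‖μ‖ = 1 ∧
      ∀ w ∈ fccSlots, ⟪w, μ⟫_ℝ = 0 ∨ ⟪w, μ⟫_ℝ = Real.sqrt (2 / 3) ∨ ⟪w, μ⟫_ℝ = -Real.sqrt (2 / 3))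
    (hw₀c : List.IsChain (fun μ μ' => ⟪μ, μ'⟫_ℝ = 1 / 3 ∨ ⟪μ, μ'⟫_ℝ = -1 / 3) w₀)
    {m : EuclideanSpace ℝ (Fin 3)} (hm : m ∈ w₀) (horth : ⟪u [], m⟫_ℝ = 0)
    (G₂ : EuclideanSpace ℝ (Fin 3) ≃ₗᵢ[ℝ] EuclideanSpace ℝ (Fin 3))
    (hG₂ : G₂ '' fccStacking 1 (Real.sqrt (2 / 3)) = wordFrame (F []) w₀ '' fccStacking 1 (Real.sqrt (2 / 3)))
    {κ : List (EuclideanSpace ℝ (Fin 3))} (hκ : WF κ) :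
    ¬ (∃ a ∈ fccSlots, ∃ a' ∈ fccSlots, ∃ a'' ∈ fccSlots,
        ⟪a, a'⟫_ℝ = 1 / 2 ∧ ⟪a, a''⟫_ℝ = 1 / 2 ∧ ⟪a', a''⟫_ℝ = 1 / 2 ∧
        (∃ w ∈ fccSlots, G₂ w = F κ a) ∧ (∃ w ∈ fccSlots, G₂ w = F κ a') ∧
        (∃ w ∈ fccSlots, G₂ w = F κ a'')) :=
  word_noTop_of_inner_zero_word hFc huc hWFc hw₀l hw₀c hm horth G₂ (image_fccSlots_eq_of_image_fcc_eq _ _ hG₂) hκ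

end Threading

end Summit.Ventures.Crystal3D.Theorems

end
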